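import Mathlib
import HarnessLib

/-!
# Route `RadicialJung`, crux `CleanModels` (stmt-15917), stub `stub_cleanLU3Defect`, class (A) «arcs»: two valuation preliminaries
# for the wrapper around `arc_core`

Line `Sketch` rev 18 of crux stmt-ResolutionOfSingularities-15917; lead `res-B-lead-1` g2.  OURS; nothing here proves resolution in
characteristic `p`.

* `exists_valuation_eq_pow_of_discrete` — for a discrete rank-one valuation ring (`v π` bounds every value `< 1`, powers of `v π` go
  below every nonzero value) every nonzero `y ∈ O` has `v y = v π ^ n` for some `n`.
* `exists_approx_le_pow_of_forall_exists_lt` — if `g₀` has NO best `p`-th-power approximation (every `f₀` is strictly improvable), then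
  along such a valuation the approximations are unbounded: `∀ N, ∃ f, v (g₀ - f^p) ≤ v π ^ N · v g₀`.
-/

noncomputable section

set_option linter.dupNamespace false -- mandated namespace of this single-conjunct summit

namespace Summit.ResolutionOfSingularities.ResolutionOfSingularities.Theorems.RadicialJung.CleanModels

variable {K : Type} [Field K]

/-- **Values are powers of `v π`** in a discrete rank-one valuation ring. [folklore] -/
theorem exists_valuation_eq_pow_of_discrete (O : ValuationSubring K) (π : K)
    (hπ : ∀ x : K, O.valuation x < 1 → O.valuation x ≤ O.valuation π)
    (harch : ∀ x : K, x ≠ 0 → ∃ n : ℕ, O.valuation π ^ n ≤ O.valuation x)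
    (y : K) (hy0 : y ≠ 0) (hy : y ∈ O) : ∃ n : ℕ, O.valuation y = O.valuation π ^ n := by
  obtain ⟨N, hN⟩ := harch y hy0
  have hy1 : O.valuation y ≤ 1 := (O.valuation_le_one_iff _).mpr hy
  -- induction on `N`, uniformly in `y`
  induction N generalizing y with
  | zero =>
    rw [pow_zero] at hN
    exact ⟨0, by rw [pow_zero]; exact le_antisymm hy1 hN⟩
  | succ n ih =>
    by_cases h1 : O.valuation y = 1
    · exact ⟨0, by rw [pow_zero, h1]⟩
    · have hlt : O.valuation y < 1 := lt_of_le_of_ne hy1 h1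
      have hle : O.valuation y ≤ O.valuation π := hπ y hlt
      have hπ0 : O.valuation π ≠ 0 := by
        intro h0
        rw [h0] at hle
        exact hy0 ((map_eq_zero O.valuation).mp (le_antisymm hle zero_le))
      have hπpos : 0 < O.valuation π := zero_lt_iff.mpr hπ0
      have hπK : π ≠ 0 := fun h0 => hπ0 (by rw [h0, map_zero])
      -- `y' = y / π`
      have hy'0 : y / π ≠ 0 := div_ne_zero hy0 hπK
      have hy'O : y / π ∈ O := by
        rw [← O.valuation_le_one_iff, map_div₀]; exact div_le_one_of_le₀ hle zero_le
      have hy'1 : O.valuation (y / π) ≤ 1 := (O.valuation_le_one_iff _).mpr hy'O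
      have hN' : O.valuation π ^ n ≤ O.valuation (y / π) := by
        rw [map_div₀, le_div_iff₀ hπpos, ← pow_succ]; exact hN
      obtain ⟨m, hm⟩ := ih (y / π) hy'0 hy'O hN' hy'1
      refine ⟨m + 1, ?_⟩
      have : y = y / π * π := (div_mul_cancel₀ y hπK).symm
      rw [this, map_mul, hm, pow_succ]

/-- **No best approximation ⟹ unbounded approximation** along a valuation with a value `v π` bounding every value `< 1`.
[folklore] -/
theorem exists_approx_le_pow_of_forall_exists_lt (O : ValuationSubring K) (π : K) {p : ℕ}
    (hπ : ∀ x : K, O.valuation x < 1 → O.valuation x ≤ O.valuation π) (g₀ : K)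
    (hdefect : ∀ f₀ : K, ∃ f₁ : K, O.valuation (g₀ - f₁ ^ p) < O.valuation (g₀ - f₀ ^ p)) (hp : p ≠ 0) :
    ∀ N : ℕ, ∃ f : K, O.valuation (g₀ - f ^ p) ≤ O.valuation π ^ N * O.valuation g₀ := by
  intro N
  induction N with
  | zero => exact ⟨0, by rw [zero_pow hp, sub_zero, pow_zero, one_mul]⟩
  | succ n ih =>
    obtain ⟨f, hf⟩ := ih
    obtain ⟨f₁, hf₁⟩ := hdefect f
    refine ⟨f₁, ?_⟩
    have hne : g₀ - f ^ p ≠ 0 := by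
      intro h0
      rw [h0, map_zero] at hf₁
      exact not_lt.mpr zero_le hf₁
    have hratio : O.valuation ((g₀ - f₁ ^ p) / (g₀ - f ^ p)) < 1 := by
      rw [map_div₀, div_lt_one₀ (zero_lt_iff.mpr ((Valuation.ne_zero_iff _).mpr hne))]; exact hf₁
    have hle := hπ _ hratio
    rw [map_div₀, div_le_iff₀ (zero_lt_iff.mpr ((Valuation.ne_zero_iff _).mpr hne))] at hle
    calc O.valuation (g₀ - f₁ ^ p) ≤ O.valuation π * O.valuation (g₀ - f ^ p) := hle
      _ ≤ O.valuation π * (O.valuation π ^ n * O.valuation g₀) := mul_le_mul_right hf _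
      _ = O.valuation π ^ (n + 1) * O.valuation g₀ := by rw [pow_succ', mul_assoc]

end Summit.ResolutionOfSingularities.ResolutionOfSingularities.Theorems.RadicialJung.CleanModels

end
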